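import Summits.ABC.IUTFork.Cor312ThetaSideExactKOfGe
import Summits.ABC.IUTFork.Cor312ThetaSideContentExactK
import Summits.ABC.IUTFork.Cor312PilotIdelesPrContentLower
import HarnessLib

/-!
# [IUTchIII] Cor. 3.12 at the `K`-level sharp setting — NONARCHIMEDEAN EXACTNESS, UNCONDITIONAL:
# `−|log(Θ)|(settingPrVolSharp (pilotDataOfK D K) …) = ↑I.negLogThetaNonarch` for every realising choice of Θ-ideles

PROOF-ONLY file (D-0012; no definitions, no `Prop` facts) of the abc-iut cell (R2 S-chain team, seat abc-iut-s2-p7 gen 3 — on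
abc-iut-s2-p6 gen 2's hand-over template — TARGET #2 `hΘ … (or =)`). TAKES NO SIDE on [IUTchIII] Cor. 3.12. The «(or =)» of the mint at
the `K` level, in its TRUE form: for the full number `=` is false (abc-iut-s2-p7 `Cor312ThetaSideStrictK`, p447833: slack
`((l+5)/4)·log π > 0`), for the NONARCHIMEDEAN part it holds. abc-iut-s2-p6's reduction
`negLogTheta_settingPrVolSharp_pilotDataOfK_eq_negLogThetaNonarch_of_ge` (`Cor312ThetaSideExactKOfGe`, p449822) has ONE input — the
per-packet REVERSE inequality `hge` at the `K` presentation — DISCHARGED here (§1) by abc-iut-s2-p7's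
`sum_content_hull_le_thetaLocal_settingPrVolSharp_untopD` (`Cor312PilotIdelesPrContentLower`: abc-iut-s2-p9's generic
`Cor312Vol.sum_content_hull_le_thetaLocal_untopD` p448133 at `presAt (pilotDataOfK D K)` — the factorwise (Ind2) of the Dupuy–Hilado
signature generates `p^m·log_p(R^×)` from the slot union of exact content `m`, [IUTchIII] Thm. 3.11 (i) (Ind2); Ism full, abc-iut-s2-p9
`Cor312IsmFullDH`) at the EXACT content family read below the tuples (abc-iut-s2-p6 `Cor312Prov.content_slotUnion_eq_contentFamily_below`,
`Cor312ThetaSideContentExactK` p448377).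

* §1 **`sum_content_below_le_thetaLocal_settingPrVolSharp_pilotDataOfK`** — `hge` VERBATIM: at every support prime `p ∈ T(I)` and label
  `i+1`, `↑(Σ_e Pr_K(e)·(−m_gen(p,i,v⃗(e))·log p + log μ̄_e(hull(log_p R_e^×)))) ≤ −|log(Θ)|_{i+1,p}` for EVERY realising Θ-idele `t`;
  `thetaLocal_settingPrVolSharp_pilotDataOfK_eq_sum_content_below` — with abc-iut-s2-p6's `≤` (p449822): per-packet EQUALITY;
* §2 **`negLogTheta_settingPrVolSharp_pilotDataOfK_eq_negLogThetaNonarch`** — for idele data `r` of `D` and EVERY realising Θ-idele `t`: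
  `(settingPrVolSharp (pilotDataOfK D K) … tq t _ _).negLogTheta = ↑(volumeInputOf D r).negLogThetaNonarch`;
  `…_of_isVolumeInputOf` — the same for ANY genuine input `I` of `D`; `genuine_negLogTheta_eq_settingPrVolSharp_pilotDataOfK_add_archLogTheta`
  — `↑I.negLogTheta = (setting).negLogTheta + ↑(((l+5)/4)·log π)`: the slack of `hΘ` is EXACTLY the archimedean term
  (`K`-level twin of abc-iut-s2-p9's `negLogTheta_volumeInputOf_eq_settingMSharp_add_archLogTheta`);
* §3 `negLogTheta_settingPrVolSharp_pilotDataOfK_eq_datum` — at a genuine Θ-volume datum `T` (the binder shape of the `K`-line certificates):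
  `= ↑T.I.negLogThetaNonarch`.

[cite: Mochizuki2012, IUTchIII Cor. 3.12 p. 173–174; Thm. 3.11 (i) p. 154] [cite: Mochizuki2012, IUTchIV Thm. 1.10 Steps (v)–(viii) p. 27–30]
[cite: DupuyHilado2025, Def. 3.6.3, §4.9, §4.12] [claim: Mochizuki2012, status: disputed] for every quoted construction.
HONEST FRAMING: an identity between OUR two typings of the nonarchimedean part of one printed quantity (sharp (Ind3) reading, DH-level
(Ind1) and factorwise (Ind2), trivial archimedean container); nothing here asserts or denies Cor. 3.12 for any initial Θ-data or takes a
side on any author; typed ≠ proved; instantiated ≠ endorsed.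
-/

noncomputable section

open Set Function NumberField IsDedekindDomain
open scoped Pointwise

namespace Summit.ABC.IUTFork.Thm311.Real

open Cor312 Cor312Vol Cor312Prov Literature.IUT.LogThetaLattice Literature.IUT.LogVolume Literature.IUT.HodgeTheaters
  Literature.NumberTheory.NumberFields

variable {F K Fbar : Type} [Field F] [NumberField F] [Field K] [NumberField K] [Algebra F K] [Field Fbar]
  [Algebra F Fbar] [Algebra K Fbar] {E : WeierstrassCurve F} [E.IsElliptic] {l : ℕ} {Pb : BadPlacePredicates K}
  (D : InitialThetaData F K Fbar E l Pb) (r : ThetaData.IdeleData D)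
  (M : Type) [Field M] [NumberField M]
  (archPk : ∀ (j : (thetaIndex (pilotDataOfK D K)).Label) (vQ : (thetaIndex (pilotDataOfK D K)).VQ),
    Set ((logShellsDH (pilotDataOfK D K) (analyticLogv K)).Packet j vQ))
  (archSub : ∀ (j : (thetaIndex (pilotDataOfK D K)).Label) (v : (thetaIndex (pilotDataOfK D K)).V),
    Set ((logShellsDH (pilotDataOfK D K) (analyticLogv K)).Packet j ((thetaIndex (pilotDataOfK D K)).over v)))
  (Ψ : ℤ → ∀ v : (thetaIndex (pilotDataOfK D K)).V, v ∈ (thetaIndex (pilotDataOfK D K)).Vbad →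
    Set ((logShellsDH (pilotDataOfK D K) (analyticLogv K)).StarPacket v))
  (act : ℤ → ∀ v : (thetaIndex (pilotDataOfK D K)).V, v ∈ (thetaIndex (pilotDataOfK D K)).Vbad →
    (logShellsDH (pilotDataOfK D K) (analyticLogv K)).StarPacket v →
      Module.End ℚ ((logShellsDH (pilotDataOfK D K) (analyticLogv K)).StarPacket v))
  (Mmod : ℤ → ∀ j : (thetaIndex (pilotDataOfK D K)).LabelStar,
    Set ((logShellsDH (pilotDataOfK D K) (analyticLogv K)).GlobalPacket j.1))
  (region : ℤ → ∀ j : (thetaIndex (pilotDataOfK D K)).LabelStar, FinDivisor M → ∀ vQ : (thetaIndex (pilotDataOfK D K)).VQ,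
    Set ((logShellsDH (pilotDataOfK D K) (analyticLogv K)).Packet j.1 vQ))
  (n : ℤ) {HT : Type} {LogLink : HT → HT → Type} {IsFull : ∀ {s t : HT}, LogLink s t → Prop}
  (lat : LGPGaussianLogThetaLattice LogLink IsFull)
  {Frd : Type} {IsoF : Frd → Frd → Type} {Ob : Frd → Type} {realify : Frd → Frd} {Strip : Type}
  {IsoS : Strip → Strip → Type}
  {Mv : ∀ v : (thetaIndex (pilotDataOfK D K)).V, v ∈ (thetaIndex (pilotDataOfK D K)).Vbad → Type} [∀ v h, Monoid (Mv v h)]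
  (sig : GlobalLGPFrobenioidSignature (thetaIndex (pilotDataOfK D K)).lstar (thetaIndex (pilotDataOfK D K)).V
    (· ∈ (thetaIndex (pilotDataOfK D K)).Vbad) Frd IsoF Ob realify Strip IsoS Mv)
  (split : SplittingMonoids Mv) {ObΔ : Type}
  {N : ∀ v : (thetaIndex (pilotDataOfK D K)).V, v ∈ (thetaIndex (pilotDataOfK D K)).Vbad → Type} [∀ v h, Monoid (N v h)]
  (qData : QPilotData ObΔ N)
  (tq : ∀ (pp : Nat.Primes) (x : (thetaIndex (pilotDataOfK D K)).Fibre (.inr pp)),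
    haveI : Fact (pp : ℕ).Prime := ⟨pp.2⟩; kOf (pilotDataOfK D K) pp.1 x)
  (t : ∀ (pp : Nat.Primes) (_ : Fin (pilotDataOfK D K).lstar) (x : (thetaIndex (pilotDataOfK D K)).Fibre (.inr pp)),
    haveI : Fact (pp : ℕ).Prime := ⟨pp.2⟩; kOf (pilotDataOfK D K) pp.1 x)
  (htq0 : ∀ pp x, tq pp x ≠ 0)
  (htq1 : ∀ (pp : Nat.Primes) (x : (thetaIndex (pilotDataOfK D K)).Fibre (.inr pp)),
    haveI : Fact (pp : ℕ).Prime := ⟨pp.2⟩; placeOf (pilotDataOfK D K) pp.1 x ∉ (pilotDataOfK D K).S → ‖tq pp x‖ = 1)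

/-! ## §1. The per-packet reverse inequality `hge` at the `K` presentation, and the per-packet equality -/

section Content

variable
  (mgen : (p : ℕ) → (i : Fin (ThetaData.volumeInputOf D r).lstar) → (Fin ((i : ℕ) + 1 + 1) → placesOver (fieldOfModuli E) p) → ℤ)
  (hmgen : ∀ (p : ℕ) [hp : Fact p.Prime], p ∈ (ThetaData.volumeInputOf D r).supportPrimes →
    ∀ (i : Fin (ThetaData.volumeInputOf D r).lstar) (e : Fin ((i : ℕ) + 1 + 1) → placesOver (fieldOfModuli E) p),
    (⋃ a : Fin ((i : ℕ) + 1 + 1), iota p (fun b => ((ThetaData.volumeInputOf D r).σ.localFieldFamily p hp.out).k (e b)) a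
          ((ThetaData.volumeInputOf D r).tΘ p hp.out i (e a) : ((ThetaData.volumeInputOf D r).σ.localFieldFamily p hp.out).k (e a)) •
        (normalizedPacket p (fun b => ((ThetaData.volumeInputOf D r).σ.localFieldFamily p hp.out).k (e b)) :
          Set (PacketAlgebra p (fun b => ((ThetaData.volumeInputOf D r).σ.localFieldFamily p hp.out).k (e b))))) ⊆
      ((p : ℚ_[p]) ^ mgen p i e) • (logPacket p (fun b => ((ThetaData.volumeInputOf D r).σ.localFieldFamily p hp.out).k (e b)) :
          Set (PacketAlgebra p (fun b => ((ThetaData.volumeInputOf D r).σ.localFieldFamily p hp.out).k (e b)))) ∧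
    ¬ (⋃ a : Fin ((i : ℕ) + 1 + 1), iota p (fun b => ((ThetaData.volumeInputOf D r).σ.localFieldFamily p hp.out).k (e b)) a
          ((ThetaData.volumeInputOf D r).tΘ p hp.out i (e a) : ((ThetaData.volumeInputOf D r).σ.localFieldFamily p hp.out).k (e a)) •
        (normalizedPacket p (fun b => ((ThetaData.volumeInputOf D r).σ.localFieldFamily p hp.out).k (e b)) :
          Set (PacketAlgebra p (fun b => ((ThetaData.volumeInputOf D r).σ.localFieldFamily p hp.out).k (e b))))) ⊆
      ((p : ℚ_[p]) ^ (mgen p i e + 1)) • (logPacket p (fun b => ((ThetaData.volumeInputOf D r).σ.localFieldFamily p hp.out).k (e b)) :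
          Set (PacketAlgebra p (fun b => ((ThetaData.volumeInputOf D r).σ.localFieldFamily p hp.out).k (e b)))))

include hmgen in
/-- **`hge` — the per-packet REVERSE inequality at the `K` presentation, VERBATIM the binder of abc-iut-s2-p6's
`negLogTheta_settingPrVolSharp_pilotDataOfK_eq_negLogThetaNonarch_of_ge`**: at every support prime `p ∈ T(I)` and label `i+1`, for EVERY
realising Θ-idele `t` over `K` (`ht0`, `hT`) and any `q`-ideles,
`↑(Σ_e Pr_K(e)·(−m_gen(p,i,v⃗(e))·log p + log μ̄_e(hull(log_p R_e^×)))) ≤ −|log(Θ)|_{i+1,p}(settingPrVolSharp (pilotDataOfK D K) … tq t _ _)` — abc-iut-s2-p7's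
`sum_content_hull_le_thetaLocal_settingPrVolSharp_untopD` (any base field; abc-iut-s2-p9's factorwise orbit-span engine p448133 with Ism FULL p449844
and the sharp-box `hwit` p450136) at the content family `m_K(e) := m_gen(p,i,v⃗(e))`, which is EXACT at every `K`-tuple by abc-iut-s2-p6's
`content_slotUnion_eq_contentFamily_below` (p448377); lifted to `WithTop` by `ThetaFinite` (`bridgeHyps_settingPrVolSharp_of_ideles`).
[cite: Mochizuki2012, IUTchIII Thm. 3.11 (i) (Ind1), (Ind2) p. 154] [cite: Mochizuki2012, IUTchIV Thm. 1.10 Step (v) p. 27–28]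
[cite: DupuyHilado2025, §4.9, §4.12] -/
theorem sum_content_below_le_thetaLocal_settingPrVolSharp_pilotDataOfK (ht0 : ∀ pp i x, t pp i x ≠ 0)
    (hT : ∀ (pp : Nat.Primes) (i : Fin (pilotDataOfK D K).lstar) (x : (thetaIndex (pilotDataOfK D K)).Fibre (.inr pp)),
      haveI : Fact (pp : ℕ).Prime := ⟨pp.2⟩
      Real.log ‖t pp i x‖ = -((pilotDataOfK D K).thetaPilot i (placeOf (pilotDataOfK D K) pp.1 x)) *
        logNorm K (placeOf (pilotDataOfK D K) pp.1 x) / localDegree K (placeOf (pilotDataOfK D K) pp.1 x))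
    (pp : Nat.Primes) (hpp : (pp : ℕ) ∈ (ThetaData.volumeInputOf D r).supportPrimes) (i : Fin (thetaIndex (pilotDataOfK D K)).lstar) :
    haveI : Fact (pp : ℕ).Prime := ⟨pp.2⟩
    ((∑ e : (presAt (pilotDataOfK D K) (logvAnalytic_analyticLogv (F := K)) pp).toLocalPieces.E (Setting.labelSucc i),
        weightPr (pilotDataOfK D K) pp.1 (Setting.labelSucc i) e *
          (-(mgen pp.1 i (fun b =>
              ⟨Literature.IUT.LogVolume.finBelow (fieldOfModuli E) K (placeOf (pilotDataOfK D K) pp.1 (e b)),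
                finBelow_mem_placesOver (fieldOfModuli E) K (placeOf_mem (pilotDataOfK D K) pp.1 (e b))⟩) * Real.log pp) +
            packetLogμ pp.1 ((presAt (pilotDataOfK D K) (logvAnalytic_analyticLogv (F := K)) pp).kk e)
              (packetHull pp.1 ((presAt (pilotDataOfK D K) (logvAnalytic_analyticLogv (F := K)) pp).kk e)
                (logPacket pp.1 ((presAt (pilotDataOfK D K) (logvAnalytic_analyticLogv (F := K)) pp).kk e) :
                  Set ((presAt (pilotDataOfK D K) (logvAnalytic_analyticLogv (F := K)) pp).X e)))) : ℝ) : WithTop ℝ) ≤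
      (settingPrVolSharp (pilotDataOfK D K) (logvAnalytic_analyticLogv (F := K)) M archPk archSub Ψ act Mmod region n lat sig split
        qData tq t htq0 htq1).thetaLocal (Setting.labelSucc i) (.inr pp) := by
  haveI : Fact (pp : ℕ).Prime := ⟨pp.2⟩
  have ht1 : ∀ (pp : Nat.Primes) (i : Fin (pilotDataOfK D K).lstar) (x : (thetaIndex (pilotDataOfK D K)).Fibre (.inr pp)),
      haveI : Fact (pp : ℕ).Prime := ⟨pp.2⟩; placeOf (pilotDataOfK D K) pp.1 x ∉ (pilotDataOfK D K).S → ‖t pp i x‖ = 1 :=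
    fun pp i x hx => norm_eq_one_of_realising_of_not_mem D t ht0 hT pp i x hx
  have hne : (settingPrVolSharp (pilotDataOfK D K) (logvAnalytic_analyticLogv (F := K)) M archPk archSub Ψ act Mmod region n lat sig
      split qData tq t htq0 htq1).thetaLocal (Setting.labelSucc i) (.inr pp) ≠ ⊤ :=
    (bridgeHyps_settingPrVolSharp_of_ideles (pilotDataOfK D K) (logvAnalytic_analyticLogv (F := K)) M archPk archSub Ψ act Mmod region n
      lat sig split qData t tq ht0 ht1 htq0 htq1).finite.1 i _
  -- abc-iut-s2-p7's reverse inequality at the EXACT content family read below the tuples (abc-iut-s2-p6 p448377)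
  have hge := sum_content_hull_le_thetaLocal_settingPrVolSharp_untopD (pilotDataOfK D K) (logvAnalytic_analyticLogv (F := K)) M archPk
    archSub Ψ act Mmod region n lat sig split qData t tq htq0 htq1 ht0 ht1 i pp
    (fun e => mgen pp.1 i (fun b =>
      ⟨Literature.IUT.LogVolume.finBelow (fieldOfModuli E) K (placeOf (pilotDataOfK D K) pp.1 (e b)),
        finBelow_mem_placesOver (fieldOfModuli E) K (placeOf_mem (pilotDataOfK D K) pp.1 (e b))⟩))
    (fun e => (content_slotUnion_eq_contentFamily_below D t (logvAnalytic_analyticLogv (F := K)) r mgen hmgen ht0 hT pp hpp i e).1)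
    (fun e => (content_slotUnion_eq_contentFamily_below D t (logvAnalytic_analyticLogv (F := K)) r mgen hmgen ht0 hT pp hpp i e).2)
  obtain ⟨c, hc⟩ := WithTop.ne_top_iff_exists.mp hne
  rw [← hc] at hge ⊢
  rw [WithTop.untopD_coe] at hge
  exact WithTop.coe_le_coe.mpr hge

include hmgen in
/-- **Per packet over a support prime, the local Θ-volume of the `K`-level sharp setting IS the exact content sum**:
`−|log(Θ)|_{i+1,p}(settingPrVolSharp (pilotDataOfK D K) … tq t _ _) = ↑(Σ_e Pr_K(e)·(−m_gen(p,i,v⃗(e))·log p + log μ̄_e(hull(log_p R_e^×))))`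
(abc-iut-s2-p6's `≤`, `thetaLocal_settingPrVolSharp_pilotDataOfK_le_sum_content_below` p449822, and `hge` above).
[cite: Mochizuki2012, IUTchIV Thm. 1.10 Step (v) p. 27–28] [cite: DupuyHilado2025, §4.12] -/
theorem thetaLocal_settingPrVolSharp_pilotDataOfK_eq_sum_content_below (ht0 : ∀ pp i x, t pp i x ≠ 0)
    (hT : ∀ (pp : Nat.Primes) (i : Fin (pilotDataOfK D K).lstar) (x : (thetaIndex (pilotDataOfK D K)).Fibre (.inr pp)),
      haveI : Fact (pp : ℕ).Prime := ⟨pp.2⟩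
      Real.log ‖t pp i x‖ = -((pilotDataOfK D K).thetaPilot i (placeOf (pilotDataOfK D K) pp.1 x)) *
        logNorm K (placeOf (pilotDataOfK D K) pp.1 x) / localDegree K (placeOf (pilotDataOfK D K) pp.1 x))
    (pp : Nat.Primes) (hpp : (pp : ℕ) ∈ (ThetaData.volumeInputOf D r).supportPrimes) (i : Fin (thetaIndex (pilotDataOfK D K)).lstar) :
    haveI : Fact (pp : ℕ).Prime := ⟨pp.2⟩
    (settingPrVolSharp (pilotDataOfK D K) (logvAnalytic_analyticLogv (F := K)) M archPk archSub Ψ act Mmod region n lat sig split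
        qData tq t htq0 htq1).thetaLocal (Setting.labelSucc i) (.inr pp) =
      ((∑ e : (presAt (pilotDataOfK D K) (logvAnalytic_analyticLogv (F := K)) pp).toLocalPieces.E (Setting.labelSucc i),
          weightPr (pilotDataOfK D K) pp.1 (Setting.labelSucc i) e *
            (-(mgen pp.1 i (fun b =>
                ⟨Literature.IUT.LogVolume.finBelow (fieldOfModuli E) K (placeOf (pilotDataOfK D K) pp.1 (e b)),
                  finBelow_mem_placesOver (fieldOfModuli E) K (placeOf_mem (pilotDataOfK D K) pp.1 (e b))⟩) * Real.log pp) +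
              packetLogμ pp.1 ((presAt (pilotDataOfK D K) (logvAnalytic_analyticLogv (F := K)) pp).kk e)
                (packetHull pp.1 ((presAt (pilotDataOfK D K) (logvAnalytic_analyticLogv (F := K)) pp).kk e)
                  (logPacket pp.1 ((presAt (pilotDataOfK D K) (logvAnalytic_analyticLogv (F := K)) pp).kk e) :
                    Set ((presAt (pilotDataOfK D K) (logvAnalytic_analyticLogv (F := K)) pp).X e)))) : ℝ) : WithTop ℝ) :=
  le_antisymm
    (thetaLocal_settingPrVolSharp_pilotDataOfK_le_sum_content_below D r mgen hmgen M archPk archSub Ψ act Mmod region n lat sig split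
      qData tq t htq0 htq1 ht0 hT pp hpp i)
    (sum_content_below_le_thetaLocal_settingPrVolSharp_pilotDataOfK D r M archPk archSub Ψ act Mmod region n lat sig split qData tq t
      htq0 htq1 mgen hmgen ht0 hT pp hpp i)

end Content

/-! ## §2. NONARCHIMEDEAN EXACTNESS of the `K`-level `−|log(Θ)|`, UNCONDITIONAL -/

/-- **NONARCHIMEDEAN EXACTNESS, UNCONDITIONAL — `(settingPrVolSharp (pilotDataOfK D K) … tq t _ _).negLogTheta = ↑(volumeInputOf D r).negLogThetaNonarch`**
for idele data `r` of the initial Θ-data `D`, EVERY realising Θ-idele `t` over `K` (`ht0`, `hT`) and ANY `q`-ideles `tq` (non-zero, units off `S`):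
abc-iut-s2-p6's reduction `negLogTheta_settingPrVolSharp_pilotDataOfK_eq_negLogThetaNonarch_of_ge` (p449822) at abc-iut-c312-3's exact content family
of the genuine input (`ThetaVolumeInput.exists_contentFamily`) with its one input `hge` DISCHARGED by §1. The «(or =)» half of the mint's TARGET #2
at the `K` level in its true form: the typed `−|log(Θ)|` of [IUTchIII] Cor. 3.12's sharp real setting over `K` IS abc-iut-S2's genuine NONARCHIMEDEAN
number; the only slack in `hΘ` is the archimedean `((l+5)/4)·log π` (abc-iut-s2-p7 `Cor312ThetaSideStrictK`). Print's factorwise (Ind2) and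
Dupuy–Hilado's full lattice group give the SAME number. [cite: Mochizuki2012, IUTchIII Cor. 3.12 p. 173–174; Thm. 3.11 (i) p. 154]
[cite: Mochizuki2012, IUTchIV Thm. 1.10 Steps (v)–(viii) p. 27–30] [cite: DupuyHilado2025, Def. 3.6.3, §4.9, §4.12] -/
theorem negLogTheta_settingPrVolSharp_pilotDataOfK_eq_negLogThetaNonarch (ht0 : ∀ pp i x, t pp i x ≠ 0)
    (hT : ∀ (pp : Nat.Primes) (i : Fin (pilotDataOfK D K).lstar) (x : (thetaIndex (pilotDataOfK D K)).Fibre (.inr pp)),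
      haveI : Fact (pp : ℕ).Prime := ⟨pp.2⟩
      Real.log ‖t pp i x‖ = -((pilotDataOfK D K).thetaPilot i (placeOf (pilotDataOfK D K) pp.1 x)) *
        logNorm K (placeOf (pilotDataOfK D K) pp.1 x) / localDegree K (placeOf (pilotDataOfK D K) pp.1 x)) :
    (settingPrVolSharp (pilotDataOfK D K) (logvAnalytic_analyticLogv (F := K)) M archPk archSub Ψ act Mmod region n lat
        sig split qData tq t htq0 htq1).negLogTheta = (((ThetaData.volumeInputOf D r).negLogThetaNonarch : ℝ) : WithTop ℝ) := by
  -- abc-iut-c312-3's exact content family of the genuine slot unions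
  obtain ⟨mgen, hmgen⟩ := (ThetaData.volumeInputOf D r).exists_contentFamily
  exact negLogTheta_settingPrVolSharp_pilotDataOfK_eq_negLogThetaNonarch_of_ge D r mgen hmgen M archPk archSub Ψ act Mmod region n lat
    sig split qData tq t htq0 htq1 ht0 hT
    (fun pp hpp i => sum_content_below_le_thetaLocal_settingPrVolSharp_pilotDataOfK D r M archPk archSub Ψ act Mmod region n lat sig
      split qData tq t htq0 htq1 mgen hmgen ht0 hT pp hpp i)

/-- **… for ANY genuine Θ-volume input `I` of `D`** (abc-iut-S2 `exists_eq_volumeInputOf`):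
`(settingPrVolSharp (pilotDataOfK D K) … tq t _ _).negLogTheta = ↑I.negLogThetaNonarch`.
[cite: Mochizuki2012, IUTchIII Cor. 3.12 p. 173–174] [cite: Mochizuki2012, IUTchIV Thm. 1.10 Steps (v)–(viii) p. 27–30] -/
theorem negLogTheta_settingPrVolSharp_pilotDataOfK_eq_negLogThetaNonarch_of_isVolumeInputOf (ht0 : ∀ pp i x, t pp i x ≠ 0)
    (hT : ∀ (pp : Nat.Primes) (i : Fin (pilotDataOfK D K).lstar) (x : (thetaIndex (pilotDataOfK D K)).Fibre (.inr pp)),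
      haveI : Fact (pp : ℕ).Prime := ⟨pp.2⟩
      Real.log ‖t pp i x‖ = -((pilotDataOfK D K).thetaPilot i (placeOf (pilotDataOfK D K) pp.1 x)) *
        logNorm K (placeOf (pilotDataOfK D K) pp.1 x) / localDegree K (placeOf (pilotDataOfK D K) pp.1 x))
    {I : ThetaVolumeInput (fieldOfModuli E) K} (hI : ThetaData.IsVolumeInputOf D I) :
    (settingPrVolSharp (pilotDataOfK D K) (logvAnalytic_analyticLogv (F := K)) M archPk archSub Ψ act Mmod region n lat
        sig split qData tq t htq0 htq1).negLogTheta = ((I.negLogThetaNonarch : ℝ) : WithTop ℝ) := by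
  obtain ⟨r, rfl⟩ := ThetaData.exists_eq_volumeInputOf D hI
  exact negLogTheta_settingPrVolSharp_pilotDataOfK_eq_negLogThetaNonarch D r M archPk archSub Ψ act Mmod region n lat sig split qData tq
    t htq0 htq1 ht0 hT

/-- **THE SLACK OF `hΘ` IS EXACTLY THE ARCHIMEDEAN TERM**: for any genuine input `I` of `D` and every realising Θ-idele,
`↑I.negLogTheta = (settingPrVolSharp (pilotDataOfK D K) … tq t _ _).negLogTheta + ↑(((l+5)/4)·log π)` (abc-iut-S2's
`negLogTheta = negLogThetaNonarch + archLogTheta l` by definition; the setting's archimedean term is `0`, trivial container). The `K`-level twin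
of abc-iut-s2-p9's `negLogTheta_volumeInputOf_eq_settingMSharp_add_archLogTheta`. [cite: Mochizuki2012, IUTchIV Thm. 1.10 Step (vii) p. 30] -/
theorem genuine_negLogTheta_eq_settingPrVolSharp_pilotDataOfK_add_archLogTheta (ht0 : ∀ pp i x, t pp i x ≠ 0)
    (hT : ∀ (pp : Nat.Primes) (i : Fin (pilotDataOfK D K).lstar) (x : (thetaIndex (pilotDataOfK D K)).Fibre (.inr pp)),
      haveI : Fact (pp : ℕ).Prime := ⟨pp.2⟩
      Real.log ‖t pp i x‖ = -((pilotDataOfK D K).thetaPilot i (placeOf (pilotDataOfK D K) pp.1 x)) *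
        logNorm K (placeOf (pilotDataOfK D K) pp.1 x) / localDegree K (placeOf (pilotDataOfK D K) pp.1 x))
    {I : ThetaVolumeInput (fieldOfModuli E) K} (hI : ThetaData.IsVolumeInputOf D I) :
    ((I.negLogTheta : ℝ) : WithTop ℝ) =
      (settingPrVolSharp (pilotDataOfK D K) (logvAnalytic_analyticLogv (F := K)) M archPk archSub Ψ act Mmod region n lat
          sig split qData tq t htq0 htq1).negLogTheta + ((ThetaVolumeInput.archLogTheta I.l : ℝ) : WithTop ℝ) := by
  rw [negLogTheta_settingPrVolSharp_pilotDataOfK_eq_negLogThetaNonarch_of_isVolumeInputOf D M archPk archSub Ψ act Mmod region n lat sig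
    split qData tq t htq0 htq1 ht0 hT hI, ← WithTop.coe_add]
  rfl

/-! ## §3. At a genuine Θ-volume DATUM (the binder shape of the `K`-line certificates) -/

/-- **At a datum `T : Cor22.ThetaVolumeDatumAt P l`**: for every context of abc-iut-c312-7's sharp setting over `T.K` at the pilot datum
`pilotDataOfK T.D T.K`, any `q`-ideles and EVERY realising Θ-idele, `(settingPrVolSharp (pilotDataOfK T.D T.K) … tq t _ _).negLogTheta =
↑T.I.negLogThetaNonarch` — the nonarchimedean part of the datum's `−|log(Θ)|` (`T.negLogTheta = T.I.negLogThetaNonarch + ((l+5)/4)·log π`).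
[cite: Mochizuki2012, IUTchIII Cor. 3.12 p. 173–174] [cite: Mochizuki2012, IUTchIV Thm. 1.10 Steps (v)–(viii) p. 27–30] -/
theorem negLogTheta_settingPrVolSharp_pilotDataOfK_eq_datum
    {P : Literature.NumberTheory.DiophantineGeometry.GenEll.NFPoint} {l : ℕ} (T : Cor22.ThetaVolumeDatumAt P l) :
    letI := T.instFieldF; letI := T.instNumberFieldF; letI := T.instAlgebraF; letI := T.instFieldK;
    letI := T.instNumberFieldK; letI := T.instAlgebraK; letI := T.instFieldFbar; letI := T.instAlgebraFbar;
    letI := T.instAlgebraKFbar; letI := T.instIsElliptic;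
    ∀ (M : Type) [Field M] [NumberField M]
      (archPk : ∀ (j : (thetaIndex (pilotDataOfK T.D T.K)).Label) (vQ : (thetaIndex (pilotDataOfK T.D T.K)).VQ),
        Set ((logShellsDH (pilotDataOfK T.D T.K) (analyticLogv T.K)).Packet j vQ))
      (archSub : ∀ (j : (thetaIndex (pilotDataOfK T.D T.K)).Label) (v : (thetaIndex (pilotDataOfK T.D T.K)).V),
        Set ((logShellsDH (pilotDataOfK T.D T.K) (analyticLogv T.K)).Packet j ((thetaIndex (pilotDataOfK T.D T.K)).over v)))
      (Ψ : ℤ → ∀ v : (thetaIndex (pilotDataOfK T.D T.K)).V, v ∈ (thetaIndex (pilotDataOfK T.D T.K)).Vbad →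
        Set ((logShellsDH (pilotDataOfK T.D T.K) (analyticLogv T.K)).StarPacket v))
      (act : ℤ → ∀ v : (thetaIndex (pilotDataOfK T.D T.K)).V, v ∈ (thetaIndex (pilotDataOfK T.D T.K)).Vbad →
        (logShellsDH (pilotDataOfK T.D T.K) (analyticLogv T.K)).StarPacket v →
          Module.End ℚ ((logShellsDH (pilotDataOfK T.D T.K) (analyticLogv T.K)).StarPacket v))
      (Mmod : ℤ → ∀ j : (thetaIndex (pilotDataOfK T.D T.K)).LabelStar,
        Set ((logShellsDH (pilotDataOfK T.D T.K) (analyticLogv T.K)).GlobalPacket j.1))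
      (region : ℤ → ∀ j : (thetaIndex (pilotDataOfK T.D T.K)).LabelStar, FinDivisor M →
        ∀ vQ : (thetaIndex (pilotDataOfK T.D T.K)).VQ, Set ((logShellsDH (pilotDataOfK T.D T.K) (analyticLogv T.K)).Packet j.1 vQ))
      (n : ℤ) {HT : Type} {LogLink : HT → HT → Type} {IsFull : ∀ {s t : HT}, LogLink s t → Prop}
      (lat : LGPGaussianLogThetaLattice LogLink IsFull)
      {Frd : Type} {IsoF : Frd → Frd → Type} {Ob : Frd → Type} {realify : Frd → Frd} {Strip : Type}
      {IsoS : Strip → Strip → Type}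
      {Mv : ∀ v : (thetaIndex (pilotDataOfK T.D T.K)).V, v ∈ (thetaIndex (pilotDataOfK T.D T.K)).Vbad → Type}
      [∀ v h, Monoid (Mv v h)]
      (sig : GlobalLGPFrobenioidSignature (thetaIndex (pilotDataOfK T.D T.K)).lstar (thetaIndex (pilotDataOfK T.D T.K)).V
        (· ∈ (thetaIndex (pilotDataOfK T.D T.K)).Vbad) Frd IsoF Ob realify Strip IsoS Mv)
      (split : SplittingMonoids Mv) {ObΔ : Type}
      {N : ∀ v : (thetaIndex (pilotDataOfK T.D T.K)).V, v ∈ (thetaIndex (pilotDataOfK T.D T.K)).Vbad → Type} [∀ v h, Monoid (N v h)]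
      (qData : QPilotData ObΔ N)
      (tq : ∀ (pp : Nat.Primes) (x : (thetaIndex (pilotDataOfK T.D T.K)).Fibre (.inr pp)),
        haveI : Fact (pp : ℕ).Prime := ⟨pp.2⟩; kOf (pilotDataOfK T.D T.K) pp.1 x)
      (t : ∀ (pp : Nat.Primes) (_ : Fin (pilotDataOfK T.D T.K).lstar) (x : (thetaIndex (pilotDataOfK T.D T.K)).Fibre (.inr pp)),
        haveI : Fact (pp : ℕ).Prime := ⟨pp.2⟩; kOf (pilotDataOfK T.D T.K) pp.1 x)
      (htq0 : ∀ pp x, tq pp x ≠ 0)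
      (htq1 : ∀ (pp : Nat.Primes) (x : (thetaIndex (pilotDataOfK T.D T.K)).Fibre (.inr pp)),
        haveI : Fact (pp : ℕ).Prime := ⟨pp.2⟩; placeOf (pilotDataOfK T.D T.K) pp.1 x ∉ (pilotDataOfK T.D T.K).S → ‖tq pp x‖ = 1),
      (∀ pp i x, t pp i x ≠ 0) →
      (∀ (pp : Nat.Primes) (i : Fin (pilotDataOfK T.D T.K).lstar) (x : (thetaIndex (pilotDataOfK T.D T.K)).Fibre (.inr pp)),
        haveI : Fact (pp : ℕ).Prime := ⟨pp.2⟩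
        Real.log ‖t pp i x‖ = -((pilotDataOfK T.D T.K).thetaPilot i (placeOf (pilotDataOfK T.D T.K) pp.1 x)) *
          logNorm T.K (placeOf (pilotDataOfK T.D T.K) pp.1 x) / localDegree T.K (placeOf (pilotDataOfK T.D T.K) pp.1 x)) →
      (settingPrVolSharp (pilotDataOfK T.D T.K) (logvAnalytic_analyticLogv (F := T.K)) M archPk archSub Ψ act Mmod region n lat
          sig split qData tq t htq0 htq1).negLogTheta = ((T.I.negLogThetaNonarch : ℝ) : WithTop ℝ) := by
  intro M _ _ archPk archSub Ψ act Mmod region n HT LogLink IsFull lat Frd IsoF Ob realify Strip IsoS Mv _ sig split ObΔ N _ qData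
    tq t htq0 htq1 ht0 hT
  letI := T.instFieldF; letI := T.instNumberFieldF; letI := T.instAlgebraF; letI := T.instFieldK
  letI := T.instNumberFieldK; letI := T.instAlgebraK; letI := T.instFieldFbar; letI := T.instAlgebraFbar
  letI := T.instAlgebraKFbar; letI := T.instIsElliptic
  exact negLogTheta_settingPrVolSharp_pilotDataOfK_eq_negLogThetaNonarch_of_isVolumeInputOf T.D M archPk archSub Ψ act Mmod region n lat
    sig split qData tq t htq0 htq1 ht0 hT T.isVolumeInputOf

end Summit.ABC.IUTFork.Thm311.Real

end
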